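import Summits.HodgeConjecture.HodgeConjecture.Theorems.AmpleAdicLefschetzWeakLefschetzInjective
import Literature.AlgebraicGeometry.HodgeTheory.HodgeTypeOfFlatSections
import Literature.AlgebraicGeometry.HodgeTheory.AlgebraicClassesHodgeTypeHolds
import HarnessLib

/-!
# Crux `WeakLefschetzAlgebraicClasses` (stmt-HodgeConjecture-1968) — stub (R) `stub_hodgeTypeReflected`

Route `AffinePartDecay`, crux #2 `Theses.AffinePartDecay.WeakLefschetzAlgebraicClasses`; registered stub (R)
`stub_hodgeTypeReflected`, shared VERBATIM by both lines of the crux (`Cruxes/WeakLefschetzAlgebraicClasses/Lines/birth.lean`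
and `…/Lines/sideways_vhc_sweep.lean` — one proof closes the stub of both skeletons):

> HODGE TYPE IS REFLECTED ALONG `i^*` IN THE WEAK-LEFSCHETZ RANGE — for a closed immersion `i : H ⟶ X` of
> smooth projective complex varieties (`dim X = n + 1`, `dim H = n`) whose complement `X ∖ i(H)` is affine,
> and `2p ≤ n`, a class `c ∈ H²ᵖ(X(ℂ); ℂ)` whose restriction `i^* c` is ALGEBRAIC on `H` is of Hodge type
> `(p, p)` on `X`.

Proof (Voisin I §7.3.2 + Prop. 11.20, Voisin II Thm. 1.23; all inputs are tree THEOREMS, no named fact):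
`i^* c ∈ Alg^p(H) ⊆ H^{p,p}(H)` (`isOfHodgeType_of_mem_algebraicClasses_of_isSmoothProjective`); the
`(p,p)`-component `c' = π_{(p,p)} c` of `c` in a Hodge model of `X` restricts to `π_{(p,p)}(i^* c) = i^* c`
(`HodgeModel.map_typeProj_eq`: pull-back commutes with the type projectors — `i^*` is a morphism of Hodge
structures — and `i^* c` is its own `(p,p)`-component); and `i^* : H²ᵖ(X(ℂ); ℂ) → H²ᵖ(H(ℂ); ℂ)` is
INJECTIVE for `2p + 1 ≤ n + 1` because the complement is ONE affine open (weak Lefschetz, injectivity half,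
`Theorems.complexBettiMap_injective_of_affineCover` = Andreotti–Frankel on the tree's carriers,
`weakLefschetzInjective_proof`). Hence `c = c'` is of type `(p, p)`.

This is the strictness of morphisms of pure Hodge structures in its simplest instance (an injective
morphism of Hodge structures reflects the Hodge type); the same linear algebra carries the Hodge type of
flat sections along families (`HodgeTypeOfFlatSections`). No definition, no named fact, no `sorry`.

References: [VoisinHodgeI2002] C. Voisin, Hodge Theory and Complex Algebraic Geometry I (2002), Thm. 6.18,
§7.3.2, Prop. 11.20; [VoisinHodgeII2003] C. Voisin, Hodge Theory and Complex Algebraic Geometry II (2003),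
§1.2.2 Thm. 1.22–1.23.
-/

-- `Summit.<Summit>.<Problem>`: for the single-conjunct summit `HodgeConjecture` the duplicate component is mandated.
set_option linter.dupNamespace false

noncomputable section

open CategoryTheory AlgebraicGeometry
open Literature.AlgebraicGeometry
open Literature.AlgebraicGeometry.Motives (SchemeOver IsSmoothProjective)
open Literature.AlgebraicGeometry.HodgeTheory
open Literature.AlgebraicTopology.SingularHomology

namespace Summit.HodgeConjecture.HodgeConjecture.Theorems

/-- **Weak Lefschetz, injectivity half, for ONE affine complement**: for a closed immersion `i : H ⟶ X`
into a smooth projective `X` of dimension `m` whose complement `X ∖ i(H)` is affine (every open with that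
carrier is an affine open), `i^* : Hʲ(X(ℂ); ℂ) → Hʲ(H(ℂ); ℂ)` is injective for `j + 1 ≤ m` — the case
`s = {X ∖ i(H)}` of `Theorems.complexBettiMap_injective_of_affineCover` (Andreotti–Frankel).
[cite: VoisinHodgeII2003, §1.2.2 Thm. 1.22–1.23] -/
theorem complexBettiMap_injective_of_affine_compl {m : ℕ} {X H : SchemeOver ℂ} (i : H ⟶ X)
    (hX : IsSmoothProjective m X) (hi : IsClosedImmersion i.left)
    (hU : ∀ U : X.left.Opens, (U : Set X.left) = (Set.range i.left.base)ᶜ → IsAffineOpen U)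
    {j : ℕ} (hj : j + 1 ≤ m) :
    Function.Injective (complexBetti.map i j) := by
  haveI := hi
  -- the complement of the (closed) image of `i` as an open of `X`
  let U : X.left.Opens := ⟨(Set.range i.left.base)ᶜ, i.left.isClosedEmbedding.isClosed_range.isOpen_compl⟩
  have hUaff : IsAffineOpen U := hU U rfl
  refine complexBettiMap_injective_of_affineCover i hX {U} (fun V hV => ?_) ?_ (by simpa using hj)
  · rw [Finset.mem_singleton] at hV
    rw [hV]
    exact hUaff
  · simp [U]

/-- **Stub (R) `stub_hodgeTypeReflected` of crux `WeakLefschetzAlgebraicClasses`** (registered signature,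
verbatim; shared by the lines `birth` and `sideways_vhc_sweep`) — HODGE TYPE IS REFLECTED ALONG `i^*` IN THE
WEAK-LEFSCHETZ RANGE: for a closed immersion `i : H ⟶ X` of smooth projective varieties (`dim X = n + 1`,
`dim H = n`) with affine complement and `2p ≤ n`, a class `c ∈ H²ᵖ(X(ℂ); ℂ)` with `i^* c ∈ Alg^p(H)` is of
Hodge type `(p, p)` on `X`. Proof: `i^* c` is of type `(p,p)` on `H` (algebraic classes are Hodge classes,
`isOfHodgeType_of_mem_algebraicClasses_of_isSmoothProjective`), so it is its own `(p,p)`-component in any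
Hodge model `M_H` of `H`; the `(p,p)`-component `π_{(p,p)} c` of `c` in a Hodge model `M_X` of `X` satisfies
`i^*(π_{(p,p)} c) = π_{(p,p)}(i^* c) = i^* c` (`HodgeModel.map_typeProj_eq`); `i^*` is injective on `H²ᵖ`
for `2p ≤ n` (`complexBettiMap_injective_of_affine_compl`), so `c = π_{(p,p)} c` is of type `(p, p)`.
[cite: VoisinHodgeI2002, §7.3.2 and Prop. 11.20] [cite: VoisinHodgeII2003, Thm. 1.23] -/
theorem stub_hodgeTypeReflected :
    ∀ ⦃n p : ℕ⦄ ⦃X H : SchemeOver ℂ⦄ (i : H ⟶ X), IsSmoothProjective (n + 1) X → IsSmoothProjective n H →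
      IsClosedImmersion i.left →
      (∀ U : X.left.Opens, (U : Set X.left) = (Set.range i.left.base)ᶜ → IsAffineOpen U) →
      2 * p ≤ n → ∀ (c : complexBetti X (2 * p)),
        complexBetti.map i (2 * p) c ∈ algebraicClasses H p →
        IsOfHodgeType (n + 1) X (2 * p) p p c := by
  intro n p X H i hX hH hi hU hp c halg
  obtain ⟨MX⟩ := nonempty_hodgeModel_holds hX
  obtain ⟨MH⟩ := nonempty_hodgeModel_holds hH
  -- the index `(p, p)` on the antidiagonal of `2p`
  have hpp : (p, p) ∈ Finset.HasAntidiagonal.antidiagonal (2 * p) :=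
    Finset.HasAntidiagonal.mem_antidiagonal.2 (two_mul p).symm
  -- `i^* c` is algebraic, hence of type `(p,p)` on `H`, i.e. lies in the `(p,p)`-piece of `M_H`
  have hiH : complexBetti.map i (2 * p) c ∈ MH.typePiece (2 * p) ⟨(p, p), hpp⟩ :=
    (MH.mem_typePiece_iff ⟨(p, p), hpp⟩ _).2
      ((isOfHodgeType_of_mem_algebraicClasses_of_isSmoothProjective hH p halg).mem_hodgePQ hH MH)
  -- the `(p,p)`-component of `c` restricts like `c`
  have hc' : complexBetti.map i (2 * p) (MX.typeProj (2 * p) ⟨(p, p), hpp⟩ c) =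
      complexBetti.map i (2 * p) c := by
    rw [MX.map_typeProj_eq hH hX i MH ⟨(p, p), hpp⟩ c]
    exact MH.typeProj_apply_of_mem hiH
  -- weak Lefschetz: `i^*` is injective on `H²ᵖ(X)` since `2p + 1 ≤ n + 1`, so `c = π_{(p,p)} c`
  have hcc : MX.typeProj (2 * p) ⟨(p, p), hpp⟩ c = c :=
    complexBettiMap_injective_of_affine_compl i hX hi hU (by omega) hc'
  have key := MX.isOfHodgeType_of_mem_typePiece (MX.typeProj_mem (2 * p) ⟨(p, p), hpp⟩ c)
  simp only at key   -- `(⟨(p, p), _⟩ : antidiagonal).1.1 ↝ p`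
  rw [hcc] at key
  exact key

end Summit.HodgeConjecture.HodgeConjecture.Theorems

end
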